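import Summits.BirchSwinnertonDyer.Rank1Residual.GaloisImage.PropagatedStructure
import Literature.NumberTheory.EllipticCurves.TateModuleProjSurjectiveProofs
import HarnessLib

/-!
# `ker(π_{k+1,*} : H¹(ℚ_v, T_pE) → H¹(ℚ_v, E[p^k·p])) ⊆ p^{k+1} · H¹(ℚ_v, T_pE)` — the exactness step
# of Lemma L's finite-level reduction (clause (C1.b) of the fine Kato package ⟨C1⟩ = `stub_fineKato`
# of crux `KatoKuriharaPortThreeShared`, stmt-BirchSwinnertonDyer-19560)
# (cell `bsd-addord`, seat kim3 gen 13; route W2 `KimAtThreeKolyvagin`; `--supports 19560`, helper)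

HONEST FRAMING. TOOL theorems only (no definition, no named fact, no `sorry`); closes nothing;
nothing is booked; BSD is not proved by any of this.  Pure Galois cohomology of the Tate module, every
prime `p`, every place `v` of `ℚ`, every depth `k`; consumed by the sibling
`Theorems/KimAtThreeFineKatoLemmaL.lean` (well-definedness of `exp*_ω mod p^{k+1}` on
`𝓕_can(v) = im π_{k+1,*}`, kim3 memo KIM3-W2-C1-g11 §2.2: "two lifts differ by
`ker(H¹(T) → H¹(E[M])) = M·H¹(ℚ₃,T)` (exactness of `H¹(T) →M H¹(T) → H¹(E[M])`)").

* `exists_eq_zsmul_of_tateLocalMap_eq_zero` — **if `π_{k+1,*}[η] = 0` then `[η] = p^{k+1} · [η″]`**: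
  `π_{k+1} ∘ η = ∂t` with `t ∈ E[p^k·p]`; lift `t` to `t̃ ∈ T_pE` (`proj_surjective_of_isAlgClosed_holds`,
  Silverman III.§7), so `η − ∂t̃` takes values in `ker π_{k+1} = p^{k+1} T_pE`, and its shift
  `(η − ∂t̃)/p^{k+1}` (n1011's `tateDivPow`) is a continuous crossed homomorphism `η″` — the cocycle-level
  pattern of n1011's `isCartesianAt_propagatedSelmerStructure` (no `H²`, no long exact sequence).
* `pow_zsmul_eq_zero` — `p^k·p` kills `H¹(ℚ_v, E[p^k·p])` (it kills the coefficients).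

References: J. H. Silverman, *AEC* III.§7 [SilvermanAEC2009]; J.-P. Serre, *Galois Cohomology* I.§2.2,
I.§5.1; C.-H. Kim, AJM 148 (2026) §3.3 Lemma 3.11 [Kim2022StructureSelmer]; kim3 memo KIM3-W2-C1-g11 §2.2.
-/

noncomputable section

-- the cell's Theorems namespace `Summit.BirchSwinnertonDyer.BirchSwinnertonDyer.…` repeats the summit name by design (D-0017)
set_option linter.dupNamespace false

open scoped Classical NumberField ContRepresentation
open Field NumberField IsDedekindDomain
open WeierstrassCurve Literature.NumberTheory.EllipticCurves Literature.NumberTheory.GaloisRepresentations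
  Literature.NumberTheory.GaloisRepresentations.DiscreteGaloisModule
open Summit.BirchSwinnertonDyer.Rank1Residual.GaloisImage

namespace Summit.BirchSwinnertonDyer.BirchSwinnertonDyer.Theorems.KimAtThreeFineKatoLocalExactness

variable (W : WeierstrassCurve ℚ) (p : ℕ) [hp : Fact p.Prime] [W.IsElliptic] (k : ℕ) (v : Place ℚ)

/-- **`ker π_{k+1,*} ⊆ p^{k+1} · H¹(ℚ_v, T_pE)`** (exactness of the long exact sequence of
`0 → T_pE →(p^{k+1}) T_pE →(π_{k+1}) E[p^{k+1}] → 0` at `H¹(ℚ_v, T_pE)`, cocycle level, no `H²`):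
if `π_{k+1,*}[η] = 0` then `π_{k+1} ∘ η = ∂t`, `t ∈ E[p^{k+1}]`; lift `t` to `t̃ ∈ T_pE`
(`proj_surjective_of_isAlgClosed_holds`), so `η − ∂t̃` takes values in `ker π_{k+1} = p^{k+1} T_pE`
and its shift `(η − ∂t̃)/p^{k+1}` (`tateDivPow`) is a continuous crossed homomorphism `η″` with
`[η] = p^{k+1} · [η″]`.  Every prime `p`, every place `v`, every `k`.
[cite: SilvermanAEC2009, III.§7 (definition of `T_ℓ(E)`, p. 87)] -/
theorem exists_eq_zsmul_of_tateLocalMap_eq_zero (y : (tateLocalRep W p v).cohomology 1)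
    (hy : tateLocalMap W p k v y = 0) :
    ∃ y' : (tateLocalRep W p v).cohomology 1, y = ((p : ℤ) ^ (k + 1)) • y' := by
  obtain ⟨η, rfl⟩ := oneCocycleClass_surjective (tateLocalRep W p v).toTopRep y
  rw [tateLocalMap_oneCocycleClass] at hy
  obtain ⟨t, ht⟩ := (oneCocycleClass_eq_zero_iff _ _).mp hy
  -- `ht g`, on underlying points: `(η g)_{k+1} = g t - t`
  have ht' : ∀ g : absoluteGaloisGroup (Place.Completion v),
      TateModule.proj p (k + 1) (η.1 g) =
        absGaloisRestrict ℚ (Place.Completion v) g • (t : geomPoints W) - (t : geomPoints W) := by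
    intro g
    exact congrArg (fun P : geomTorsion W ((p : ℤ) ^ k * (p : ℤ)) => (P : geomPoints W)) (ht g)
  -- lift `t` to `T_pE` and absorb its coboundary into `η`
  obtain ⟨tT, htT⟩ := proj_surjective_of_isAlgClosed_holds W p (k + 1)
    ((mem_geomTorsion_pow_mul_iff W p k _).mp t.2)
  set η' : contOneCocycles (tateLocalRep W p v).toTopRep :=
    η - principalCocycle _ tT (continuous_tateLocalRep_apply W p v tT) with hη'
  have hη'apply : ∀ g : absoluteGaloisGroup (Place.Completion v),
      η'.1 g = η.1 g - ((tateLocalRep W p v).toTopRep.ρ g tT - tT) := fun g => rfl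
  -- `(η' g)_{k+1} = 0`
  have hk0 : ∀ g : absoluteGaloisGroup (Place.Completion v),
      TateModule.proj p (k + 1) (η'.1 g) = 0 := by
    intro g
    rw [hη'apply, map_sub, map_sub, ContinuousRep.toTopRep_ρ_apply, tateLocalRep_apply_apply,
      TateModule.proj_smul_of_distribMulAction, htT, ht' g, sub_self]
  -- the divided crossed homomorphism `η'' = η' / p^{k+1}`
  let f'' : absoluteGaloisGroup (Place.Completion v) → W.tateModule p :=
    fun g => tateDivPow (k + 1) (η'.1 g) (hk0 g)
  have hf''val : ∀ (g : absoluteGaloisGroup (Place.Completion v)) (n : ℕ),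
      TateModule.proj p n (f'' g) = TateModule.proj p (n + (k + 1)) (η'.1 g) := fun g n => rfl
  have hcont'' : Continuous f'' :=
    continuous_induced_rng.2
      (continuous_pi fun n => (TateModule.continuous_proj (n + (k + 1))).comp η'.1.continuous)
  have hcoc'' : ∀ g h : absoluteGaloisGroup (Place.Completion v),
      f'' (g * h) = f'' g + (tateLocalRep W p v).toTopRep.ρ g (f'' h) := by
    intro g h
    apply TateModule.ext
    intro n
    rw [hf''val, map_add, hf''val, ContinuousRep.toTopRep_ρ_apply, tateLocalRep_apply_apply,
      TateModule.proj_smul_of_distribMulAction, hf''val, η'.2 g h, map_add,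
      ContinuousRep.toTopRep_ρ_apply, tateLocalRep_apply_apply,
      TateModule.proj_smul_of_distribMulAction]
  let η'' : contOneCocycles (tateLocalRep W p v).toTopRep := ⟨⟨f'', hcont''⟩, hcoc''⟩
  have hη''apply : ∀ g : absoluteGaloisGroup (Place.Completion v), η''.1 g = f'' g := fun g => rfl
  -- `η' = p^{k+1} • η''`, pointwise then as cocycles
  have hpt : ∀ g : absoluteGaloisGroup (Place.Completion v),
      η'.1 g = ((p : ℤ) ^ (k + 1)) • η''.1 g := by
    intro g
    apply TateModule.ext
    intro n
    rw [map_zsmul, hη''apply, hf''val, ← Nat.cast_pow, natCast_zsmul, add_comm n (k + 1),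
      TateModule.pow_smul_proj_self_add]
  have hsmul : η' = ((p : ℤ) ^ (k + 1)) • η'' := by
    apply Subtype.ext
    apply ContinuousMap.ext
    intro g
    rw [hpt g]
    simp
  -- `[η] = [η'] = p^{k+1} • [η'']`
  refine ⟨oneCocycleClass _ η'', ?_⟩
  have hcls : oneCocycleClass (tateLocalRep W p v).toTopRep η =
      oneCocycleClass (tateLocalRep W p v).toTopRep η' := by
    rw [hη', oneCocycleClass_sub, oneCocycleClass_principalCocycle, sub_zero]
  rw [hcls, hsmul]
  exact map_zsmul (oneCocycleClassₗ (tateLocalRep W p v).toTopRep).toAddMonoidHom _ η''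

omit hp [W.IsElliptic] in
/-- **A class of `H¹(ℚ_v, E[p^k·p])` is killed by `p^k·p`** (its coefficients are). [folklore] -/
theorem pow_zsmul_eq_zero
    (x : galoisCohomology ((W.torsionGaloisModule ((p : ℤ) ^ k * (p : ℤ))).toLocal v) 1) :
    ((p : ℤ) ^ k * (p : ℤ)) • x = 0 := by
  obtain ⟨ξ, rfl⟩ :=
    oneCocycleClass_surjective ((W.torsionGaloisModule ((p : ℤ) ^ k * (p : ℤ))).toLocal v).toTopRep x
  have hξ : ((p : ℤ) ^ k * (p : ℤ)) • ξ = 0 := by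
    apply Subtype.ext
    apply ContinuousMap.ext
    intro g
    rw [AddSubgroupClass.coe_zsmul, ContinuousMap.zsmul_apply, Submodule.coe_zero,
      ContinuousMap.zero_apply]
    apply Subtype.ext
    have hmem := (ξ.1 g).2
    rw [mem_geomTorsion_iff] at hmem
    rw [AddSubgroupClass.coe_zsmul]
    exact hmem
  have h := map_zsmul (oneCocycleClassₗ
    ((W.torsionGaloisModule ((p : ℤ) ^ k * (p : ℤ))).toLocal v).toTopRep).toAddMonoidHom
    ((p : ℤ) ^ k * (p : ℤ)) ξ
  rw [LinearMap.toAddMonoidHom_coe, oneCocycleClassₗ_apply, hξ, oneCocycleClassₗ_apply,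
    oneCocycleClass_zero] at h
  exact h.symm



end Summit.BirchSwinnertonDyer.BirchSwinnertonDyer.Theorems.KimAtThreeFineKatoLocalExactness

end
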